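import Summits.QuantumFields.BalabanUV.Beta.FP.TowerFAnchorParities

/-!
# `BalabanUV.Beta.FP.TowerGLiteralParities` — road «FP», binder row D1, ROUTE T (β1), (H5-G) TABLED, FILE G2: **THE G-SYSTEM's FOUR PARITY LETTERS AT THE LITERAL TOP
# STEP, EVERY LEVEL** — at `𝒱G (n+1) := vertexOfK (GcombSh Lc (n+1)) Lc (JsB12CombSh⁰ … (n+1)).S`, `𝒲bG (n+1) B :=` the source-wound even half of `(JsB12CombSh⁰ … (n+1)).W`,
# v10 `StepRecursionFeedNestedNamedI`'s binders `hVGm hVGt hWGm hWGt` (L.261–264) ARE THEOREMS (torus and multiplier-valued index map generic; the END feeds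
# `M := fine Lc (Mc B)`, `f := a ↦ (coarsePt (Mc B) Lc a.1, inr a.2)`)

WHY (located).  Road g59 A-1 l.69037 (G-LIT): FILE G1 `TowerGLiteralLetters` tables `hVG hWG hδG hWGw hG` at the literal top step; THIS FILE tables the four parities, so that
at that choice the (H5-G) box displays exactly its four KKT-transport junctions `hHG₁ hQG₁ hHG₂ hQG₂` (an2 g79 W-5 (3): «until the other ELEVEN G-letters are tabled BY NAME»).
FILE 7 `TowerFAnchorParities` did level `0` for the DRESSED storey-1 F-families; here the UNDRESSED literal families at EVERY level `j`: the first-order letters are leaf BF-x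
`LiteralStencilSockets.JsB12CombSh0_S_an1_inr_inr ∕ _inl_inr` (level-generic) through lit `vertexOfK_apply(_eq_zero)`; the second-order mm-freeness `WGlit_inr_inr` is FILE 7's
`WG0_inr_inr` at level `0` and, at level `j+1`, the recursion's own placement: `SpureRecOf_succ` = cubic `e3OfK` (ff-placed, `StepReflectionRec.e3OfK_inr_inr`) + `cVH·wVH • V`
(an1's `V` mm-free), `T2RecOf_succ` = `e4OfKW` (= `mmRead …`, lit `mmRead_inr_left`) + `cB·wB2 • vh₂S` (mm-free), `M1Of ∕ M2Of` ff-only — fed the row's `W2SymOfK_apply_eq_zero`.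

THE CANDIDATE, HONESTLY (an2 g81 W-5 l.69039 (4)): this `G` is «the literal's own top step read through the comb chart `GcombSh Lc (n+1)`» — v10 displays the G-leg as
`GcombSh Lc (n + 1 - 0)`; `JsB12CombSh0 … (n+1)` is the RAW (undressed) jet record, the two dressing functors living in `GcombSh` (the row's `CombChartJointEnd.TbalOf_JsB12CombShSym`,
as FILE 6 `TowerFAnchorRow` reads it at level `0`).  The END's choice of `G` STAYS FREE (W-5 (3) l.68883 stands at the END of record); these are library letters about a NAMED
candidate, true whatever the END instantiates; skeletons P ∕ Q are xreads, NOT filed, and their count is NOT the END of record's.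

WHAT ([folklore] fibre bookkeeping BY NAME; no `def`, no `def … : Prop`, nothing cited, 0 sorry).
* §1 pointwise, every level `j`: `VGlit_inr_inr`, `VGlit_inl_inr_transpose`, **`WGlit_inr_inr`**.
* §2 **`hVGm_lit`**, **`hVGt_lit`** — v10's `hVGm ∕ hVGt` (L.261–262) at `(𝒱G (n + 1))` ↦ the literal's level-`(n+1)` first-order family, torus `M` and index map `f` (multiplier
  fibres) generic (FILE 7 §3's two proofs with the undressed letters; `PeriodisedBorderTables.perZ_dper_symm`).
* §3 **`hWGm_lit`**, **`hWGt_lit`** — v10's `hWGm ∕ hWGt` (L.263–264) at `(𝒲bG (n + 1)) B` ↦ the source-wound even half on a box `Mb` (road `WoundEvenFamilyParities` rows; `hWGt`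
  needs no letter of the family — graded-evenness of an even half, GAN24 `parityEven_evenHalf`).
WHAT THIS IS NOT: not the junctions `hHG₁ hQG₁ hHG₂ hQG₂`; NO END edit (skeleton Q = `mkEndSkel59.py --gpar` is an xread); nothing of Bałaban's asserted, valued or discharged;
0 estimates; 0∕4 row-D1 binders (hW ∕ hR ∕ D1Tel ∕ D1Rep); ROOT M‴ p325680 ∕ P5c ∕ D6 untouched; NOT (C1), NOT (T-ID), NOT D1, NEVER «G-an2-4 closed», NOT BetaPertH, NOT continuum, NOT Clay.
HONEST DEPENDENCY (page 1, mandatory): continuum YM on T⁴ ⇐ BetaPertH ∧ nine spine estimates (0/9 proved); BetaPertH ⇐ (D1) ∧ (D4) ∧ CAP+tail;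
G-an2-4 gates asym, D1 and NE2/3/4.  HONEST FRAMING (cell contract, verbatim): «discharging `BetaPertH` makes Bałaban's UV stability UNCONDITIONAL —
a real constructive-QFT result; it is NOT the continuum limit and NOT the Clay problem.»  ABSOLUTE RULE (cell charter, verbatim): «No internally-minted
statement may enter as a cited fact. Every hypothesis is either kernel-proved in this package or a verbatim quotation of a PUBLISHED theorem with page
reference. The manuscript(s) under audit are NOT citable for their own disputed steps — they are the thing under adjudication; programme-internal
(2001/route/tribunal) claims are never citable.»  Road «FP» OWNER, b2b-balaban-beta-d1-p3 gen 59, 2026-08-29.  No existing file touched.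
-/

noncomputable section

open scoped BigOperators

namespace Summit.QuantumFields.BalabanUV.Beta.FP.TowerGLiteralParities

open Literature.MathematicalPhysics.QuantumFieldTheory.Balaban1983to89
open Literature.MathematicalPhysics.QuantumFieldTheory.Balaban1983to89.Beta
open B4TorusKernel.MultiPeriod (translate)
open B6Lemma24Torus (pbox)
open ExpKernelCalculus (Site MKer)
open OneStepResolventKernel (Fib)
open OneStepKernelFamily (vertexOfK)
open StepJetData (wilsonA)
open WilsonBiStencil (wilsonW₂ wilsonW₂_inr_inr)
open BalabanStepW2 (M2Of)
open BalabanStepJetsSucc (mmRead_inr_left)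
open Summit.QuantumFields.BalabanUV.Beta.TameKernelCalculus (trK)
open Summit.QuantumFields.BalabanUV.Beta.BorderedHessian (sgnK)
open Summit.QuantumFields.BalabanUV.Beta.BubbleParity (vertexOfK_apply_eq_zero)
open Summit.QuantumFields.BalabanUV.Beta.CombHId1Letters (vertexOfK_apply)
open Summit.QuantumFields.BalabanUV.Beta.SpineRooted (SpureRecOf SpureRecOf_zero_level SpureRecOf_succ WrecOf T2RecOf T2RecOf_zero_level T2RecOf_succ WrecOf_eq M1Of M1Of_apply
  e4OfKW e3OfK e3OfK_inr_inr)
open Summit.QuantumFields.BalabanUV.Beta.ChartStepJets (WchartOf WchartOf_eq WchartOf_GcombSh)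
open Summit.QuantumFields.BalabanUV.Beta.SymAveragingHessianCounts (symHessFFAt symHessFFAt_inr)
open Summit.QuantumFields.BalabanUV.Beta.SymSecondOrderTablesAn1 (symTablesAn1S2 symTablesAn1S2_M symTablesAn1S2_vh₂S symTablesAn1S2_mixFF symVh₂SAn1_inr_inr
  symTablesAn1S2_mixFF_inr)
open Summit.QuantumFields.BalabanUV.Beta.CombChartStepJets (GcombSh JsB12CombSh0 JsB12CombSh0_eq JsComb0Of_W)
open Summit.QuantumFields.BalabanUV.Beta.D1BFx.LiteralStencilSockets (JsB12CombSh0_S_an1_inr_inr JsB12CombSh0_S_an1_inl_inr symTablesAn1S2_V_inr_inr)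
open Summit.QuantumFields.BalabanUV.Beta.NVertexParitiesW (W2SymOfK_apply_eq_zero)
open Summit.QuantumFields.BalabanUV.Beta.GAN24.SecondOrderReadersParity (parityEven_evenHalf)
open Summit.QuantumFields.BalabanUV.Beta.FP.KernelPeriodisationFib (Idx perF perZ perF_apply perZ_apply)
open Summit.QuantumFields.BalabanUV.Beta.FP.KernelPeriodisationFibLoc (dper dper_apply)
open Summit.QuantumFields.BalabanUV.Beta.FP.PeriodisedBorderTables (perZ_dper_symm)
open Summit.QuantumFields.BalabanUV.Beta.FP.WoundEvenFamilyParities (parityEven_tsum inr_inr_tsum_eq_zero inr_inr_evenHalf_eq_zero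
  perF_dper_apply_eq_zero_of_inr_inr perF_dper_antitwin_fμ_of_parityEven)

variable {Lc : ℕ} [NeZero Lc] (hLc : Odd Lc) (N : ℕ) (cΛ cB : ℝ)

/-! ## §1 The literal's level-`j` families, pointwise on the fibre blocks -/

section Pointwise

/-- [folklore] **THE LITERAL's LEVEL-`j` FIRST-ORDER FAMILY HAS NO MULTIPLIER–MULTIPLIER BLOCK** (leaf BF-x `JsB12CombSh0_S_an1_inr_inr` through `vertexOfK_apply_eq_zero`;
FILE 7's `VG0_inr_inr` is `j = 0`). -/
theorem VGlit_inr_inr (j : ℕ) (c : Fin (3 + 1)) (t x z : Site (3 + 1)) (m m' : Fin (3 + 1)) :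
    vertexOfK (GcombSh (d := 3) Lc j) Lc (JsB12CombSh0 hLc N (symTablesAn1S2 3 Lc cΛ) cΛ cB j).S c t x z (Sum.inr m) (Sum.inr m') = 0 :=
  vertexOfK_apply_eq_zero (K := GcombSh (d := 3) Lc j) (N := Lc)
    (fun κ' u x' z' => JsB12CombSh0_S_an1_inr_inr hLc N cΛ cB j κ' u x' z' m m') c t x z

/-- [folklore] **ITS FIELD–MULTIPLIER ENTRY IS THE TRANSPOSED MULTIPLIER–FIELD ENTRY** at every level (leaf BF-x `JsB12CombSh0_S_an1_inl_inr`, termwise in `vertexOfK_apply`). -/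
theorem VGlit_inl_inr_transpose (j : ℕ) (c : Fin (3 + 1)) (t x z : Site (3 + 1)) (α m : Fin (3 + 1)) :
    vertexOfK (GcombSh (d := 3) Lc j) Lc (JsB12CombSh0 hLc N (symTablesAn1S2 3 Lc cΛ) cΛ cB j).S c t x z (Sum.inl α) (Sum.inr m)
      = vertexOfK (GcombSh (d := 3) Lc j) Lc (JsB12CombSh0 hLc N (symTablesAn1S2 3 Lc cΛ) cΛ cB j).S c t z x (Sum.inr m) (Sum.inl α) := by
  rw [vertexOfK_apply, vertexOfK_apply]
  simp only [JsB12CombSh0_S_an1_inl_inr]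

/-- [folklore] **THE LITERAL's LEVEL-`j` SECOND-ORDER FAMILY HAS NO MULTIPLIER–MULTIPLIER BLOCK**: it IS the swap-symmetrised carrier `W2SymOfK` at level `j` of the comb-chart slot
recursion over `symTablesAn1S2` (`rfl` chain), and every level-`j` table there is mm-free — level `0` as FILE 7's `WG0_inr_inr`; level `j+1`: the pure first-order table is
`cE·wE • e3OfK + cVH·wVH • V` (`e3OfK` ff-placed, an1's `V` mm-free), the second field partials are `cE₂·wV4 • e4OfKW + cB·wB2 • vh₂S` (`e4OfKW = mmRead …`, `vh₂S` mm-free),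
`M1Of ∕ M2Of` ff-only; the row's `W2SymOfK_apply_eq_zero`. -/
theorem WGlit_inr_inr (j : ℕ) (μ : Fin (3 + 1)) (y : Site (3 + 1)) (ν : Fin (3 + 1)) (y' x z : Site (3 + 1)) (m m' : Fin (3 + 1)) :
    (JsB12CombSh0 hLc N (symTablesAn1S2 3 Lc cΛ) cΛ cB j).W μ y ν y' x z (Sum.inr m) (Sum.inr m') = 0 := by
  rw [JsB12CombSh0_eq, JsComb0Of_W, ← WchartOf_GcombSh, WchartOf_eq, WrecOf_eq]
  refine W2SymOfK_apply_eq_zero (fun κ u x' z' => ?_) (fun ρ w x' z' => ?_) (fun κ u κ' u' x' z' => ?_) (fun κ u ρ w x' z' => ?_) μ y ν y' x z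
  · -- the PURE first-order member at level `j`: mm-free at every level
    cases j with
    | zero =>
      simp only [SpureRecOf_zero_level, Pi.add_apply, Pi.smul_apply, smul_eq_mul, symTablesAn1S2_V_inr_inr, mul_zero, add_zero]
      exact mul_eq_zero_of_right _ rfl
    | succ j =>
      simp only [SpureRecOf_succ, Pi.add_apply, Pi.smul_apply, smul_eq_mul, e3OfK_inr_inr, symTablesAn1S2_V_inr_inr, mul_zero, add_zero]
  · -- the multiplier table `M1Of … symHessFFAt …`: ff-only
    rw [symTablesAn1S2_M, M1Of_apply, Pi.smul_apply, Pi.smul_apply, Pi.smul_apply, Pi.smul_apply, smul_eq_mul, symHessFFAt_inr, mul_zero]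
  · -- the second field partials at level `j`
    cases j with
    | zero =>
      simp only [T2RecOf_zero_level, Pi.add_apply, Pi.smul_apply, smul_eq_mul, symTablesAn1S2_vh₂S, wilsonW₂_inr_inr, symVh₂SAn1_inr_inr, mul_zero, add_zero]
    | succ j =>
      rw [T2RecOf_succ]
      simp only [Pi.add_apply, Pi.smul_apply, smul_eq_mul, symTablesAn1S2_vh₂S, symVh₂SAn1_inr_inr, mul_zero, add_zero]
      exact mul_eq_zero_of_right _ (mmRead_inr_left Lc _ x' z' m (Sum.inr m'))
  · -- the mixed partials `wM2 • mixFF`: ff-only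
    simp only [M2Of, Pi.smul_apply, smul_eq_mul, symTablesAn1S2_mixFF_inr, mul_zero]

end Pointwise

/-! ## §2 `hVGm hVGt` AT THE LITERAL TOP STEP — v10's binders (L.261–262) with `(𝒱G (n + 1))` ↦ the literal's level-`(n+1)` first-order family; torus `M`, index map `f` generic -/

section RecordV

/-- [folklore] **`hVGm` AT THE LITERAL TOP STEP** — on two indices landing in multiplier fibres the periodised literal first-order family VANISHES
(the END feeds `M := fine Lc (Mc B)`, `f := a ↦ (coarsePt (Mc B) Lc a.1, inr a.2)`, `hf := a ↦ ⟨a.2, rfl⟩`, `j := n + 1`). -/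
theorem hVGm_lit {M : Fin (3 + 1) → ℕ} [∀ i, NeZero (M i)] {ι : Type*} (f : ι → Idx M (Fib 3)) (hf : ∀ a : ι, ∃ m : Fin (3 + 1), (f a).2 = Sum.inr m)
    (j : ℕ) (μ : Fin (3 + 1)) (y : Fin (3 + 1) → ℤ) (a a' : ι) :
    (perF M (dper M (vertexOfK (GcombSh (d := 3) Lc j) Lc (JsB12CombSh0 hLc N (symTablesAn1S2 3 Lc cΛ) cΛ cB j).S μ y))) (f a) (f a') = 0 := by
  obtain ⟨m, hm⟩ := hf a
  obtain ⟨m', hm'⟩ := hf a'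
  have ha : f a = ((f a).1, Sum.inr m) := Prod.ext rfl hm
  have ha' : f a' = ((f a').1, Sum.inr m') := Prod.ext rfl hm'
  rw [ha, ha', perF_apply]
  simp only [perZ_apply, dper_apply, VGlit_inr_inr, tsum_zero]

/-- [folklore] **`hVGt` AT THE LITERAL TOP STEP** — a field index against an index in a multiplier fibre reads the same both ways (FILE 7's `hVFt_zero` argument, undressed:
road `PeriodisedBorderTables.perZ_dper_symm` on the block-symmetrised kernel). -/
theorem hVGt_lit {M : Fin (3 + 1) → ℕ} [∀ i, NeZero (M i)] {ι : Type*} (f : ι → Idx M (Fib 3)) (hf : ∀ a : ι, ∃ m : Fin (3 + 1), (f a).2 = Sum.inr m)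
    (j : ℕ) (μ : Fin (3 + 1)) (y : Fin (3 + 1) → ℤ) (b : ↥(pbox M) × Fin (3 + 1)) (a : ι) :
    (perF M (dper M (vertexOfK (GcombSh (d := 3) Lc j) Lc (JsB12CombSh0 hLc N (symTablesAn1S2 3 Lc cΛ) cΛ cB j).S μ y))) (b.1, Sum.inl b.2) (f a)
      = (perF M (dper M (vertexOfK (GcombSh (d := 3) Lc j) Lc (JsB12CombSh0 hLc N (symTablesAn1S2 3 Lc cΛ) cΛ cB j).S μ y))) (f a) (b.1, Sum.inl b.2) := by
  obtain ⟨m, hm⟩ := hf a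
  have ha : f a = ((f a).1, Sum.inr m) := Prod.ext rfl hm
  have hsym := fun x z α' m' => VGlit_inl_inr_transpose hLc N cΛ cB j μ y x z α' m'
  rw [ha, perF_apply, perF_apply]
  generalize vertexOfK (GcombSh (d := 3) Lc j) Lc (JsB12CombSh0 hLc N (symTablesAn1S2 3 Lc cΛ) cΛ cB j).S μ y = K at hsym ⊢
  let S : MKer (3 + 1) (Fib 3) := fun x z a' b' =>
    match a', b' with
    | Sum.inl α', Sum.inr m₁ => K x z (Sum.inl α') (Sum.inr m₁)
    | Sum.inr m₁, Sum.inl α' => K z x (Sum.inl α') (Sum.inr m₁)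
    | _, _ => 0
  have hS : ∀ (x z : Site (3 + 1)) (a' b' : Fib 3), S x z a' b' = S z x b' a' := by
    intro x z a' b'
    rcases a' with α' | m₁ <;> rcases b' with α'' | m₂ <;> rfl
  have e1 : perZ M (dper M K) ((b.1 : ↥(pbox M)) : Site (3 + 1)) (((f a).1 : ↥(pbox M)) : Site (3 + 1)) (Sum.inl b.2) (Sum.inr m)
      = perZ M (dper M S) ((b.1 : ↥(pbox M)) : Site (3 + 1)) (((f a).1 : ↥(pbox M)) : Site (3 + 1)) (Sum.inl b.2) (Sum.inr m) := by
    simp only [perZ_apply, dper_apply]; rfl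
  have e2 : perZ M (dper M K) (((f a).1 : ↥(pbox M)) : Site (3 + 1)) ((b.1 : ↥(pbox M)) : Site (3 + 1)) (Sum.inr m) (Sum.inl b.2)
      = perZ M (dper M S) (((f a).1 : ↥(pbox M)) : Site (3 + 1)) ((b.1 : ↥(pbox M)) : Site (3 + 1)) (Sum.inr m) (Sum.inl b.2) := by
    simp only [perZ_apply, dper_apply, ← hsym]; rfl
  rw [e1, e2]
  exact perZ_dper_symm M hS _ _ _ _

end RecordV

/-! ## §3 `hWGm hWGt` AT THE LITERAL TOP STEP — v10's binders (L.263–264) with `(𝒲bG (n + 1)) B` ↦ the source-wound even half of the literal's level-`(n+1)` second-order family -/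

section RecordW

variable {M : Fin (3 + 1) → ℕ} (Mb : Fin (3 + 1) → ℕ) {ι : Type*} (f : ι → Idx M (Fib 3)) (hf : ∀ a : ι, ∃ m : Fin (3 + 1), (f a).2 = Sum.inr m)
include hf

/-- [folklore] **`hWGm` AT THE LITERAL TOP STEP** — on two multiplier-fibre indices the periodised source-wound even half VANISHES (road `WoundEvenFamilyParities` rows over
§1 `WGlit_inr_inr`; box `Mb` for `Mc B`, `j := n + 1`). -/
theorem hWGm_lit (j : ℕ) (μ : Fin (3 + 1)) (y : Fin (3 + 1) → ℤ) (ν : Fin (3 + 1)) (y' : Fin (3 + 1) → ℤ) (a a' : ι) :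
    (perF M (dper M ((fun μ y ν y' => (fun x z a b => ∑' e : Site (3 + 1), ((1 / 2 : ℝ) • ((JsB12CombSh0 hLc N (symTablesAn1S2 3 Lc cΛ) cΛ cB j).W μ y ν (translate Mb y' e) + sgnK (trK ((JsB12CombSh0 hLc N (symTablesAn1S2 3 Lc cΛ) cΛ cB j).W μ y ν (translate Mb y' e))))) x z a b)) μ y ν y'))) (f a) (f a') = 0 :=
  perF_dper_apply_eq_zero_of_inr_inr M f hf
    (fun x z m m' => inr_inr_tsum_eq_zero _ (fun e x' z' m₁ m₂ => inr_inr_evenHalf_eq_zero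
      (fun x'' z'' m₃ m₄ => WGlit_inr_inr hLc N cΛ cB j μ y ν (translate Mb y' e) x'' z'' m₃ m₄) x' z' m₁ m₂) x z m m') a a'

/-- [folklore] **`hWGt` AT THE LITERAL TOP STEP** — the (field, multiplier) border of the periodised source-wound even half is the ANTI-twin of its (multiplier, field) border
(graded-evenness of an even half: road `parityEven_tsum` over GAN24 `parityEven_evenHalf`; no letter of the family needed). -/
theorem hWGt_lit (j : ℕ) (μ : Fin (3 + 1)) (y : Fin (3 + 1) → ℤ) (ν : Fin (3 + 1)) (y' : Fin (3 + 1) → ℤ) (b : ↥(pbox M) × Fin (3 + 1)) (a : ι) :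
    (perF M (dper M ((fun μ y ν y' => (fun x z a b => ∑' e : Site (3 + 1), ((1 / 2 : ℝ) • ((JsB12CombSh0 hLc N (symTablesAn1S2 3 Lc cΛ) cΛ cB j).W μ y ν (translate Mb y' e) + sgnK (trK ((JsB12CombSh0 hLc N (symTablesAn1S2 3 Lc cΛ) cΛ cB j).W μ y ν (translate Mb y' e))))) x z a b)) μ y ν y'))) (b.1, Sum.inl b.2) (f a)
      = -((perF M (dper M ((fun μ y ν y' => (fun x z a b => ∑' e : Site (3 + 1), ((1 / 2 : ℝ) • ((JsB12CombSh0 hLc N (symTablesAn1S2 3 Lc cΛ) cΛ cB j).W μ y ν (translate Mb y' e) + sgnK (trK ((JsB12CombSh0 hLc N (symTablesAn1S2 3 Lc cΛ) cΛ cB j).W μ y ν (translate Mb y' e))))) x z a b)) μ y ν y'))) (f a) (b.1, Sum.inl b.2)) :=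
  perF_dper_antitwin_fμ_of_parityEven M f hf (parityEven_tsum _ fun _ => parityEven_evenHalf _) b a

end RecordW

end Summit.QuantumFields.BalabanUV.Beta.FP.TowerGLiteralParities

end
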